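import Summits.BirchSwinnertonDyer.BirchSwinnertonDyer.Theorems.KolyvaginRoadThreeZhangInductionOn
import Summits.BirchSwinnertonDyer.BirchSwinnertonDyer.Theorems.KolyvaginRoadThreeMethod2Defs
import Summits.BirchSwinnertonDyer.BirchSwinnertonDyer.Theorems.KolyvaginRoadThreeMethod2ClassesFromBottom
import Summits.BirchSwinnertonDyer.Rank1Residual.X11b.Three.KolyvaginLine
import Literature.NumberTheory.EllipticCurves.HeegnerPointsOfConductorRationality
import Literature.NumberTheory.EllipticCurves.KolyvaginShaStructureDivisibility

/-!
# KOLY method line, stub B as ROUTE-POSITED DATA: `LevelRaisedKolyvaginDatum`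
# (route `KolyvaginRoadThree`, crux stmt-BirchSwinnertonDyer-19574 `ZhangSharpFrameAtThreeHL`; text = planner
# bsd-stepL-plan g27's DRAFT `plan/KOLY-B/KolyvaginRoadThreeMethod2Datum-draft.lean` b49eb8141a2bbecc VERBATIM, landed with
# one probe theorem added by the ACCEL seat bsd-stepL-koly3b g2; `--supports stmt-BirchSwinnertonDyer-19574 --as helper`)

Vocabulary only (no mathematics): the witnesses `κ, m₁` and the four conjuncts (realisation ∕ (A2) transport ∕ (A3)
triangulation ∕ (A5) base case) of the REGISTERED stub `stub_kolyvaginClassesAtThree` of crux stmt-BirchSwinnertonDyer-19574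
`ZhangSharpFrameAtThreeHL` (skeleton v2x a0f4fb3beb7452f2, owner bsd-stepL-koly g12) packaged as ONE structure over the
tree's `Method2Defs` objects (`V3`, `IsUAdmissiblePrime`, `GoodLevel`, `SelQ`, `SelRelQ`, `baseLocusQ`), so that
(A2)∕(A3)∕(A5) have NAMES: hands can land them field by field, and the p ≥ 5 printed analogues (W. Zhang CJM 2014
Thm 4.3 ∕ Lemma 8.4 ∕ Thm 7.2) can later be typed over the same shapes. The interface does NOT smuggle existence:
`Nonempty (LevelRaisedKolyvaginDatum …)` at every HL A1 frame IS stub B (theorem `stub_kolyvaginClassesAtThree_of_datum`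
below is the verbatim repackaging) and stays OPEN. Asked by koly g12 (HANDOFF § koly g12, NEXT (3)); the gate refuses
definition items with a `Summits/…` topic, hence a `Theorems/` file.

WHAT THE DATUM PINS (koly3b g2, `Theorems/KolyvaginRoadThreeMethod2ClassesFromBottom.lean` p471571, memo
`HOME/koly3b/STUB-B-ABOVE-BOTTOM-19574.md`, evidence #38 on 19574). At `n = ∅` the classes are pinned (`realisation`); at
`n ≠ ∅` the field `κ` is FREE, and `transport` ∕ `triangulation` ∕ `baseCase` do not tie it to the level-raised forms:
`nonempty_datum_of_cruxAt_of_oddRank_of_cover_of_bottom` below builds a datum from (i) the crux's OWN conclusion at the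
frame, (ii) odd total canonical rank at good even levels (= (FLIP) + the parity stub), (iii) a covering family
`M → H¹(K, E[3])` (Poitou–Tate-grade junk) and (iv) the `triangulation` field AT `n = ∅` only (which the induction never
reads, `ZhangInductionOnPos`, p471131) — with `κ m n :=` junk for `n ≠ ∅` and `m₁ :=` the crux witness. So
`Nonempty (LevelRaisedKolyvaginDatum …)` is, given stubs A and P and the covering family, EQUIVALENT to the crux at the
frame (`cruxAt_iff_consumedCoherent`, p471747): a hand «landing a field» above the bottom proves nothing about Zhang's
`c(m, n)`; the structure is the right SHAPE for the day the level-raised objects are typed (then `κ` is pinned by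
construction and the three fields become Thm 4.3 ∕ Lemma 8.4 ∕ Thm 7.2 at `p = 3`). [cite: WZhang2014, Thm. 4.3, Lemma 8.4,
Thm. 7.2, §9 proof of Thm. 9.1]
-/

noncomputable section

open scoped Classical

namespace Summit.BirchSwinnertonDyer.Rank1Residual.X11b.Three.Koly.Method2

open WeierstrassCurve NumberField IsDedekindDomain CategoryTheory
  Literature.NumberTheory.EllipticCurves Literature.NumberTheory.EllipticCurves.ModularForms
  Literature.NumberTheory.GaloisRepresentations Module

/-- W. Zhang's LEVEL-RAISED KOLYVAGIN CLASSES at `p = 3` as route-posited data: classes `κ m n ∈ H¹(K, E[3])`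
(`m` = Kolyvagin-supported Kolyvagin–Heegner data of the frame, `n` a finite set of unipotent-admissible primes;
Zhang's `c(m, n)` on `X_{N⁺, N⁻·∏n}` ∕ the Shimura set) with a bottom index `m₁`, PINNED at `n = ∅` to the frame's
concrete Kolyvagin classes, and the three axioms the induction consumes at GOOD levels. Fields = the conjuncts of the
registered stub `stub_kolyvaginClassesAtThree` VERBATIM. [cite: WZhang2014, §3–§4, Thm. 4.3, Lemma 8.4, Thm. 7.2] -/
structure LevelRaisedKolyvaginDatum (W : WeierstrassCurve ℚ) [W.IsElliptic] [W.IsGloballyMinimal]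
    [NeZero (W.conductorNorm ℤ)] (K : Type) [Field K] [NumberField K]
    (Dt : ModularParametrizationData W (W.conductorNorm ℤ)) (β : ℤ) (ι : K →+* ℂ) (c : K ≃ₐ[ℚ] K)
    [Module (ZMod 3) (V3 W K)] where
  /-- the level-raised classes `c(m, n) ∈ H¹(K, E[3])` -/
  κ : {x : (n : ℕ) × KolyvaginHeegnerData Dt β ι n //
        KolyvaginDescent.KolSupp (Zhang2014.IsKolyvaginPrime (W.conductorNorm ℤ) W K 3) x.1} →
      Finset {q // IsUAdmissiblePrime W K q} → V3 W K
  /-- the bottom index used in the base case -/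
  m₁ : {x : (n : ℕ) × KolyvaginHeegnerData Dt β ι n //
        KolyvaginDescent.KolSupp (Zhang2014.IsKolyvaginPrime (W.conductorNorm ℤ) W K 3) x.1}
  /-- REALISATION: at level `∅` the classes ARE the frame's Kolyvagin classes mod 3. -/
  realisation : ∀ m, κ m ∅ = m.1.2.kolyvaginClass Nat.prime_three 1
  /-- (A2) congruence transport along two good steps, base locus defined from `κ` (Zhang Thm 4.3). -/
  transport : ∀ (n : Finset {q // IsUAdmissiblePrime W K q}) (q₁ q₂ : {q // IsUAdmissiblePrime W K q}),
      GoodLevel W K n → GoodLevel W K (insert q₁ n) → GoodLevel W K (insert q₂ (insert q₁ n)) →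
      q₁ ∉ n → q₂ ∉ insert q₁ n → q₂ ∉ baseLocusQ W K κ (insert q₂ (insert q₁ n)) → ∃ m, κ m n ≠ 0
  /-- (A3) triangulation with finiteness at a good even level carrying a non-zero class (Zhang Lemma 8.4 (1)+(3)). -/
  triangulation : ∀ (n : Finset {q // IsUAdmissiblePrime W K q}), GoodLevel W K n → Even n.card →
      (∃ m, κ m n ≠ 0) →
      ∃ (s : Bool) (d : ℕ), finrank (ZMod 3) (SelQ W K c n s) = d + 1 ∧
        SelQ W K c n s = SelRelQ W K c n (baseLocusQ W K κ n) s ∧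
        FiniteDimensional (ZMod 3) (SelRelQ W K c n (baseLocusQ W K κ n) (!s)) ∧
        finrank (ZMod 3) (SelRelQ W K c n (baseLocusQ W K κ n) (!s)) ≤ d
  /-- (A5) base case: canonical total rank one at a good even level (Zhang Thm 7.2). -/
  baseCase : ∀ (n : Finset {q // IsUAdmissiblePrime W K q}), GoodLevel W K n → Even n.card →
      finrank (ZMod 3) (SelQ W K c n true) + finrank (ZMod 3) (SelQ W K c n false) = 1 → κ m₁ n ≠ 0

/-- The registered stub B `stub_kolyvaginClassesAtThree` (skeleton v2x, crux 19574) VERBATIM, from a datum at every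
HL A1 frame — pure repackaging (anonymous constructor), no mathematics. -/
theorem stub_kolyvaginClassesAtThree_of_datum
    (hD : ∀ (W : WeierstrassCurve ℚ) [W.IsElliptic] [W.IsGloballyMinimal] [NeZero (W.conductorNorm ℤ)] (K : Type)
      [Field K] [NumberField K] (Dt : ModularParametrizationData W (W.conductorNorm ℤ)) (β : ℤ) (ι : K →+* ℂ),
      Summit.BirchSwinnertonDyer.Rank1Residual.ClassX11b W 3 → W.HasMultiplicativeReductionAtPrime 3 →
      Rank1Residual.Surj W 3 → Rank1Residual.Ram W 3 → ¬ 3 ∣ W.tamagawaProduct → IsImaginaryQuadratic K →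
      Odd (NumberField.discr K) → SatisfiesHeegnerHypothesis (W.conductorNorm ℤ) K →
      (W.quadraticTwist (NumberField.discr K : ℚ)).entireLFunction 1 ≠ 0 → NumberField.discr K ≠ -3 →
      (4 * (W.conductorNorm ℤ : ℤ)) ∣ β ^ 2 - NumberField.discr K → ¬ (3 : ℤ) ∣ Dt.c →
      ∀ (c : K ≃ₐ[ℚ] K), c ≠ 1 → ∀ [Module (ZMod 3) (V3 W K)],
      Nonempty (LevelRaisedKolyvaginDatum W K Dt β ι c)) :
    ∀ (W : WeierstrassCurve ℚ) [W.IsElliptic] [W.IsGloballyMinimal] [NeZero (W.conductorNorm ℤ)] (K : Type)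
      [Field K] [NumberField K] (Dt : ModularParametrizationData W (W.conductorNorm ℤ)) (β : ℤ) (ι : K →+* ℂ),
      Summit.BirchSwinnertonDyer.Rank1Residual.ClassX11b W 3 → W.HasMultiplicativeReductionAtPrime 3 →
      Rank1Residual.Surj W 3 → Rank1Residual.Ram W 3 → ¬ 3 ∣ W.tamagawaProduct → IsImaginaryQuadratic K →
      Odd (NumberField.discr K) → SatisfiesHeegnerHypothesis (W.conductorNorm ℤ) K →
      (W.quadraticTwist (NumberField.discr K : ℚ)).entireLFunction 1 ≠ 0 → NumberField.discr K ≠ -3 →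
      (4 * (W.conductorNorm ℤ : ℤ)) ∣ β ^ 2 - NumberField.discr K → ¬ (3 : ℤ) ∣ Dt.c →
      ∀ (c : K ≃ₐ[ℚ] K), c ≠ 1 → ∀ [Module (ZMod 3) (V3 W K)],
      ∃ (κ : {x : (n : ℕ) × KolyvaginHeegnerData Dt β ι n //
              KolyvaginDescent.KolSupp (Zhang2014.IsKolyvaginPrime (W.conductorNorm ℤ) W K 3) x.1} →
            Finset {q // IsUAdmissiblePrime W K q} → V3 W K)
        (m₁ : {x : (n : ℕ) × KolyvaginHeegnerData Dt β ι n //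
              KolyvaginDescent.KolSupp (Zhang2014.IsKolyvaginPrime (W.conductorNorm ℤ) W K 3) x.1}),
        -- REALISATION (identity in H¹(K, E[3]))
        (∀ m, κ m ∅ = m.1.2.kolyvaginClass Nat.prime_three 1) ∧
        -- (A2) congruence transport along two good steps, base locus defined from κ
        (∀ (n : Finset {q // IsUAdmissiblePrime W K q}) (q₁ q₂ : {q // IsUAdmissiblePrime W K q}),
          GoodLevel W K n → GoodLevel W K (insert q₁ n) → GoodLevel W K (insert q₂ (insert q₁ n)) →
          q₁ ∉ n → q₂ ∉ insert q₁ n → q₂ ∉ baseLocusQ W K κ (insert q₂ (insert q₁ n)) → ∃ m, κ m n ≠ 0) ∧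
        -- (A3) triangulation at a good even level carrying a non-zero class
        (∀ (n : Finset {q // IsUAdmissiblePrime W K q}), GoodLevel W K n → Even n.card → (∃ m, κ m n ≠ 0) →
          ∃ (s : Bool) (d : ℕ), finrank (ZMod 3) (SelQ W K c n s) = d + 1 ∧
            SelQ W K c n s = SelRelQ W K c n (baseLocusQ W K κ n) s ∧
            FiniteDimensional (ZMod 3) (SelRelQ W K c n (baseLocusQ W K κ n) (!s)) ∧
            finrank (ZMod 3) (SelRelQ W K c n (baseLocusQ W K κ n) (!s)) ≤ d) ∧
        -- (A5) base case: canonical rank one at a good even level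
        (∀ (n : Finset {q // IsUAdmissiblePrime W K q}), GoodLevel W K n → Even n.card →
          finrank (ZMod 3) (SelQ W K c n true) + finrank (ZMod 3) (SelQ W K c n false) = 1 → κ m₁ n ≠ 0) := by
  intro W _ _ _ K _ _ Dt β ι hX hmult hsurj hram htam hK hodd hH hLt h3 hβ hc c hc1 _
  obtain ⟨D⟩ := hD W K Dt β ι hX hmult hsurj hram htam hK hodd hH hLt h3 hβ hc c hc1
  exact ⟨D.κ, D.m₁, D.realisation, D.transport, D.triangulation, D.baseCase⟩

/-- Converse repackaging at one frame: stub B's witnesses give a datum. -/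
theorem nonempty_datum_of_witnesses (W : WeierstrassCurve ℚ) [W.IsElliptic] [W.IsGloballyMinimal]
    [NeZero (W.conductorNorm ℤ)] (K : Type) [Field K] [NumberField K]
    (Dt : ModularParametrizationData W (W.conductorNorm ℤ)) (β : ℤ) (ι : K →+* ℂ) (c : K ≃ₐ[ℚ] K)
    [Module (ZMod 3) (V3 W K)]
    (κ : {x : (n : ℕ) × KolyvaginHeegnerData Dt β ι n //
        KolyvaginDescent.KolSupp (Zhang2014.IsKolyvaginPrime (W.conductorNorm ℤ) W K 3) x.1} →
      Finset {q // IsUAdmissiblePrime W K q} → V3 W K)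
    (m₁ : {x : (n : ℕ) × KolyvaginHeegnerData Dt β ι n //
        KolyvaginDescent.KolSupp (Zhang2014.IsKolyvaginPrime (W.conductorNorm ℤ) W K 3) x.1})
    (h0 : ∀ m, κ m ∅ = m.1.2.kolyvaginClass Nat.prime_three 1)
    (h2 : ∀ (n : Finset {q // IsUAdmissiblePrime W K q}) (q₁ q₂ : {q // IsUAdmissiblePrime W K q}),
      GoodLevel W K n → GoodLevel W K (insert q₁ n) → GoodLevel W K (insert q₂ (insert q₁ n)) →
      q₁ ∉ n → q₂ ∉ insert q₁ n → q₂ ∉ baseLocusQ W K κ (insert q₂ (insert q₁ n)) → ∃ m, κ m n ≠ 0)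
    (h3 : ∀ (n : Finset {q // IsUAdmissiblePrime W K q}), GoodLevel W K n → Even n.card →
      (∃ m, κ m n ≠ 0) →
      ∃ (s : Bool) (d : ℕ), finrank (ZMod 3) (SelQ W K c n s) = d + 1 ∧
        SelQ W K c n s = SelRelQ W K c n (baseLocusQ W K κ n) s ∧
        FiniteDimensional (ZMod 3) (SelRelQ W K c n (baseLocusQ W K κ n) (!s)) ∧
        finrank (ZMod 3) (SelRelQ W K c n (baseLocusQ W K κ n) (!s)) ≤ d)
    (h5 : ∀ (n : Finset {q // IsUAdmissiblePrime W K q}), GoodLevel W K n → Even n.card →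
      finrank (ZMod 3) (SelQ W K c n true) + finrank (ZMod 3) (SelQ W K c n false) = 1 → κ m₁ n ≠ 0) :
    Nonempty (LevelRaisedKolyvaginDatum W K Dt β ι c) :=
  ⟨⟨κ, m₁, h0, h2, h3, h5⟩⟩

/-- **What the datum pins above the bottom: nothing** (signature-truth probe, koly3b g2). A `LevelRaisedKolyvaginDatum`
EXISTS at a frame as soon as (CRUX@frame) some concrete Kolyvagin class of the frame is non-zero mod 3, (PAR) the total
canonical rank is odd at every non-empty good even level [(FLIP) + 3-parity of `Sel₃(E/K)`], (COV) there is a family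
`M → H¹(K, E[3])` indexed by the frame's Kolyvagin data whose localisations cover the unipotent-admissible primes
[Poitou–Tate; `M` is infinite], and (A3)@∅ the `triangulation` field holds AT THE BOTTOM for the concrete classes — by
`stubB_body_of_cruxAt_of_oddRank_of_cover_of_bottom` (`κ m n :=` nowhere-zero junk for `n ≠ ∅`, `m₁ :=` the crux
witness). No level-raised form, no congruence (Thm 4.3), no base case (Thm 7.2) enters. [cite: WZhang2014, §9 proof of
Thm. 9.1, Lemma 8.4] -/
theorem nonempty_datum_of_cruxAt_of_oddRank_of_cover_of_bottom (W : WeierstrassCurve ℚ) [W.IsElliptic]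
    [W.IsGloballyMinimal] [NeZero (W.conductorNorm ℤ)] (K : Type) [Field K] [NumberField K]
    (Dt : ModularParametrizationData W (W.conductorNorm ℤ)) (β : ℤ) (ι : K →+* ℂ) (c : K ≃ₐ[ℚ] K)
    [Module (ZMod 3) (V3 W K)]
    (hcrux : ∃ (n : ℕ) (d : KolyvaginHeegnerData Dt β ι n),
      KolyvaginDescent.KolSupp (Zhang2014.IsKolyvaginPrime (W.conductorNorm ℤ) W K 3) n ∧
        d.kolyvaginClass Nat.prime_three 1 ≠ 0)
    (hpar : ∀ (n : Finset {q // IsUAdmissiblePrime W K q}), GoodLevel W K n → n.Nonempty → Even n.card →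
      Odd (finrank (ZMod 3) (SelQ W K c n true) + finrank (ZMod 3) (SelQ W K c n false)))
    (hcov : ∃ j : {x : (n : ℕ) × KolyvaginHeegnerData Dt β ι n //
          KolyvaginDescent.KolSupp (Zhang2014.IsKolyvaginPrime (W.conductorNorm ℤ) W K 3) x.1} → V3 W K,
      ∀ q : {q // IsUAdmissiblePrime W K q}, ∃ m, ∃ v : HeightOneSpectrum (𝓞 K), ((q : ℕ) : 𝓞 K) ∈ v.asIdeal ∧
        j m ∉ (W.baseChange K).torsionLocalKer (v.adicCompletion K) ((3 ^ 1 : ℕ) : ℤ))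
    (hbot : (∃ m : {x : (n : ℕ) × KolyvaginHeegnerData Dt β ι n //
          KolyvaginDescent.KolSupp (Zhang2014.IsKolyvaginPrime (W.conductorNorm ℤ) W K 3) x.1},
        m.1.2.kolyvaginClass Nat.prime_three 1 ≠ 0) →
      ∃ (s : Bool) (d : ℕ), finrank (ZMod 3) (SelQ W K c ∅ s) = d + 1 ∧
        SelQ W K c ∅ s = SelRelQ W K c ∅ (baseLocusQ W K
          (fun (m : {x : (n : ℕ) × KolyvaginHeegnerData Dt β ι n //
              KolyvaginDescent.KolSupp (Zhang2014.IsKolyvaginPrime (W.conductorNorm ℤ) W K 3) x.1})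
            (_ : Finset {q // IsUAdmissiblePrime W K q}) ↦ m.1.2.kolyvaginClass Nat.prime_three 1) ∅) s ∧
        FiniteDimensional (ZMod 3) (SelRelQ W K c ∅ (baseLocusQ W K
          (fun (m : {x : (n : ℕ) × KolyvaginHeegnerData Dt β ι n //
              KolyvaginDescent.KolSupp (Zhang2014.IsKolyvaginPrime (W.conductorNorm ℤ) W K 3) x.1})
            (_ : Finset {q // IsUAdmissiblePrime W K q}) ↦ m.1.2.kolyvaginClass Nat.prime_three 1) ∅) (!s)) ∧
        finrank (ZMod 3) (SelRelQ W K c ∅ (baseLocusQ W K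
          (fun (m : {x : (n : ℕ) × KolyvaginHeegnerData Dt β ι n //
              KolyvaginDescent.KolSupp (Zhang2014.IsKolyvaginPrime (W.conductorNorm ℤ) W K 3) x.1})
            (_ : Finset {q // IsUAdmissiblePrime W K q}) ↦ m.1.2.kolyvaginClass Nat.prime_three 1) ∅) (!s)) ≤ d) :
    Nonempty (LevelRaisedKolyvaginDatum W K Dt β ι c) := by
  obtain ⟨κ, m₁, h0, h2, h3, h5⟩ :=
    stubB_body_of_cruxAt_of_oddRank_of_cover_of_bottom W K c Dt β ι hcrux hpar hcov hbot
  exact ⟨⟨κ, m₁, h0, h2, h3, h5⟩⟩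

end Summit.BirchSwinnertonDyer.Rank1Residual.X11b.Three.Koly.Method2
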